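import Summits.BirchSwinnertonDyer.BirchSwinnertonDyer.Theorems.ThetaPartnerAtTwoSignedKatoUpToAtTwoPointsColemanLinear
import Summits.BirchSwinnertonDyer.BirchSwinnertonDyer.Theorems.ThetaPartnerAtTwoSignedKatoUpToAtTwoPointsColemanKernel
import Summits.BirchSwinnertonDyer.BirchSwinnertonDyer.Theorems.ThetaPartnerAtTwoSignedKatoUpToAtTwoPointsSemilinearLambda
import Summits.BirchSwinnertonDyer.BirchSwinnertonDyer.Theorems.ThetaPartnerAtTwoSignedKatoUpToAtTwoPointsLocalCover
import Summits.BirchSwinnertonDyer.BirchSwinnertonDyer.Theorems.ThetaPartnerAtTwoSignedKatoUpToAtTwoPointsModelJTwo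
import HarnessLib

/-!
# Route `ThetaPartnerAtTwo` (TP2), crux K3 `SignedKatoDivisibilityUpToAtTwo` (item stmt-BirchSwinnertonDyer-20308),
# line `colemanrat` v5 — THE POINTS-MODEL HALF OF THE PACKAGE (R2^ι), ASSEMBLED at `p = 2`

Lead `bsd-wall-tp2-p2x` g4 (cell `bsd-wall`). HONEST FRAMING: THEOREMS ONLY (existential form; no definition, no named fact,
no instance, no `sorry`); closes no item; BSD is NOT proved by any of this.

The registered stub `Cruxes.SignedKatoDivisibilityUpToAtTwo.ColemanRat.stub_localRobustPackageTwoInv` (R2^ι) asks, per place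
`v ∋ 2` and pinned dual `D`, for a `Λ`-module `P`, a `Λ`-LINEAR `ι_P : P → Λ` with `2^m`-torsion kernel, an ADDITIVE
`ι`-SEMILINEAR `j : P → X⁺` with the LOCAL COVER, plus the `𝐇¹`-side data (`col`, `s`, reciprocity, Euler system, zeta bound).
This file delivers the whole `P`-side with `m = 0` and NO hypothesis beyond the habitat, a local lift `g` of the generator, a plus
Honda system `d` at `v` ((L)(TR)(GEN)(GEN₀), ∃-supplied by HONDA⁺@2) and a points-model `j₀` with its Kummer value formula
(∃-supplied by `KummerPoint.exists_pointsModelJ_two`):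
`P := Hom(E(ℚ_{2,∞}·ℚ_v), ℤ₂) ⧸ Ker Col♭` with Sprung's `Λ`-structure `moduleOfGenerator`, `ι_P := Col♭` (INJECTIVE on `P`),
`q :=` the projection (`Λ`-compatible, onto), `j := j₀ ∘ (restriction to A⁺)` descended along `Ker Col♭ ⊆ ker j₀`
(`…PointsColemanKernel`), `ι`-semilinear (`…PointsSemilinearLambda`), covering `{x : X⁺ | x ⟂ Sel⁺ ∩ ker res_𝔭}` (`…PointsLocalCover`).
What is NOT here (the research residue of R2^ι): the `T₂E`-adic local Tate pairing as a map `col₀ : 𝐇¹ → Hom(E(ℚ_{2,∞}·ℚ_v), ℤ₂)`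
(then `col := q ∘ col₀`), Poitou–Tate along `ℚ_∞` (`j ∘ col = 0`), and the explicit reciprocity law at `2` (`ι_P (col z_Kato) ~ L♭`).

## What is proved
* `exists_pointsPackage_two` — the `P`-side of (R2^ι) at `p = 2`, sign `+`/`♭` (index `1`), exponent `m = 0`, with the presentation
  clauses (`q` onto and `Λ`-compatible, `ι_P ∘ q = Col♭`, `j ∘ q = j₀ ∘ res_{A⁺}`) a closer needs to attach the `𝐇¹` side.

References: [Kobayashi2003] Thm. 6.2, (7.17), (8.23); [Sprung2012] Def. 5.9, Def. 7.9, Prop. 7.14; [Kato2004Asterisque] §17.13.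
-/

set_option autoImplicit false
-- the Theorems namespace of this sub repeats the summit name by design (D-0017 nested layout)
set_option linter.dupNamespace false

noncomputable section

open scoped Classical

namespace Summit.BirchSwinnertonDyer.BirchSwinnertonDyer.Theorems

namespace SignedKatoOffTwo.KummerPoint

open NumberField IsDedekindDomain Field WeierstrassCurve
  Literature.NumberTheory.EllipticCurves Literature.NumberTheory.EllipticCurves.Kobayashi2003
  Literature.NumberTheory.EllipticCurves.GreenbergSelmer
  Literature.NumberTheory.EllipticCurves.Sprung2012 Literature.NumberTheory.GaloisRepresentations ZpExtension

variable (W : WeierstrassCurve ℚ) [W.IsElliptic] [W.IsGloballyMinimal] {κ : ZpExtension ℚ 2} {γ : absoluteGaloisGroup ℚ}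

/-- **The points-model half of the `ι`-repaired package (R2^ι) at `p = 2`, assembled.** On K3's habitat (`W/ℚ` globally minimal,
`GoodSS W 2`, cyclotomic `κ` with generator `γ`, `v ∋ 2`, pinned plus dual `D`), given a local lift `g` of the generator, a plus Honda
system `d` at `v` and a points-model `j₀` with its Kummer value formula, there are a `Λ`-module `P`, a `Λ`-linear INJECTIVE
`ι_P : P → Λ`, an additive `Λ`-compatible surjection `q : Hom(E(ℚ_{2,∞}·ℚ_v), ℤ₂) → P` (for Sprung's action `lambdaSMul`) and an
additive `j : P → D.X` with: `ι_P (q z) = Col♭ z` (the ♭-Coleman value of `z`, which exists and is unique); `j (q z) = j₀ (z|_{A⁺})`;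
`j (f • y) = ι(f) • j y` for all `f ∈ Λ` (`ι = IwasawaAlgebra.invol 2`); and the LOCAL COVER with exponent `0`: every `x ∈ D.X`
orthogonal to `Sel⁺_∞ ∩ ker res_𝔭` is a value of `j`. (`P = Hom ⧸ Ker Col♭`, `ι_P = Col♭`, `q` = projection.)
[cite: Kobayashi2003, Thm. 6.2 (p. 11), (7.17) (p. 12), (8.23)] [cite: Sprung2012, Def. 5.9 (p. 1495), Def. 7.9 (p. 1503)]
[cite: Kato2004Asterisque, §17.13] -/
theorem exists_pointsPackage_two (hss : Rank1Residual.GoodSS W 2) (hκ : κ.IsCyclotomic) (hγ : κ.IsTopGenerator γ)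
    (v : HeightOneSpectrum (𝓞 ℚ)) (hv : (2 : 𝓞 ℚ) ∈ v.asIdeal)
    {g : absoluteGaloisGroup (v.adicCompletion ℚ)} (hg : κ.IsTopGenerator (resGalOfEmb (closureEmb (K := ℚ) (v.adicCompletion ℚ)) g))
    {d : ℕ → localPoints W (v.adicCompletion ℚ)} (hd : ∀ m, d m ∈ localLayerPoints κ (v.adicCompletion ℚ) W m)
    (htr : ∀ m, localTrace κ (v.adicCompletion ℚ) W (m + 1) (m + 2) (d (m + 2)) = -d m)
    (hgen : ∀ m : ℕ, 1 ≤ m → ∀ P ∈ localLayerPoints κ (v.adicCompletion ℚ) W m,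
      ∃ B ∈ AddSubgroup.closure (Set.range fun σ : absoluteGaloisGroup (v.adicCompletion ℚ) ↦ σ • d m),
        ∃ P' ∈ localLayerPoints κ (v.adicCompletion ℚ) W (m - 1), ∃ R ∈ localLayerPoints κ (v.adicCompletion ℚ) W m,
          P = B + P' + 2 • R)
    (hgen0 : ∀ P ∈ localLayerPoints κ (v.adicCompletion ℚ) W 0, ∃ a : ℤ, ∃ R ∈ localLayerPoints κ (v.adicCompletion ℚ) W 0,
      P = a • d 0 + 2 • R)
    (D : SignedSelmerDualData W κ γ 1)
    (j₀ : (↥(⨆ n, signedLocalPoints κ (v.adicCompletion ℚ) W 1 n) →+ ℤ_[2]) →+ D.X)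
    (hj : ∀ (φA : ↥(⨆ n, signedLocalPoints κ (v.adicCompletion ℚ) W 1 n) →+ ℤ_[2])
        (s : W.subgroupH1 2 κ.kerSubgroup) (hs : s ∈ signedSelmerInfty W κ 1)
        (φ : contOneCocycles (discreteTopRep κ.kerSubgroup (W.geomPrimaryTorsion 2)))
        (Q : localPoints W (v.adicCompletion ℚ)) (k : ℕ)
        (_ : oneCocycleClass _ φ = s) (hQ : 2 ^ k • Q ∈ (⨆ n, signedLocalPoints κ (v.adicCompletion ℚ) W 1 n))
        (_ : ∀ τ : localSubgroupOfEmb κ.kerSubgroup (closureEmb (K := ℚ) (v.adicCompletion ℚ)),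
          pointsMapOfEmb W (closureEmb (K := ℚ) (v.adicCompletion ℚ))
              ((φ.1 (resGalSubgroupOfEmb κ.kerSubgroup _ τ) : W.geomPrimaryTorsion 2) : W.geomPoints) =
            (τ : absoluteGaloisGroup (v.adicCompletion ℚ)) • Q - Q),
        D.toDual (j₀ φA) ⟨s, hs⟩ =
          (PadicInt.toZModPow k (φA ⟨2 ^ k • Q, hQ⟩)).val • ((((2 : ℚ) ^ k)⁻¹ : ℚ) : AddCircle (1 : ℚ))) :
    ∃ (P : Type) (_ : AddCommGroup P) (_ : Module (IwasawaAlgebra 2) P)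
      (ιP : P →ₗ[IwasawaAlgebra 2] IwasawaAlgebra 2)
      (q : (localTowerPointsOfEmb κ (closureEmb (K := ℚ) (v.adicCompletion ℚ)) W →+ ℤ_[2]) →+ P) (j : P →+ D.X),
      Function.Injective ιP ∧ Function.Surjective q ∧
      (∀ (f : IwasawaAlgebra 2) (z : localTowerPointsOfEmb κ (closureEmb (K := ℚ) (v.adicCompletion ℚ)) W →+ ℤ_[2]),
        q (lambdaSMul κ (closureEmb (K := ℚ) (v.adicCompletion ℚ)) W hg f z) = f • q z) ∧
      (∀ z, ∃ Ls, IsColemanPair κ (closureEmb (K := ℚ) (v.adicCompletion ℚ)) W 0 g d z Ls (ιP (q z))) ∧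
      (∀ z Ls Lf, IsColemanPair κ (closureEmb (K := ℚ) (v.adicCompletion ℚ)) W 0 g d z Ls Lf → ιP (q z) = Lf) ∧
      (∀ z, j (q z) = j₀ (z.comp (AddSubgroup.inclusion (iSup_signedLocalPoints_le_localTowerPointsOfEmb W 2 κ 1 v)))) ∧
      (∀ (f : IwasawaAlgebra 2) (y : P), j (f • y) = IwasawaAlgebra.invol 2 f • j y) ∧
      (∀ x : D.X,
        (∀ t : signedSelmerInfty W κ 1,
          resOfLe (W.geomPrimaryTorsion 2) (inf_le_left : κ.kerSubgroup ⊓ decomp v ≤ κ.kerSubgroup)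
            (t : W.subgroupH1 2 κ.kerSubgroup) = 0 → D.toDual x t = 0) →
        ∃ y : P, j y = x) := by
  have hv' : ((2 : ℕ) : 𝓞 ℚ) ∈ v.asIdeal := by exact_mod_cast hv
  letI inst := moduleOfGenerator κ (closureEmb (K := ℚ) (v.adicCompletion ℚ)) W hg
  -- Sprung's Coleman map as a `Λ`-linear map, and its ♭-component
  obtain ⟨Col, hCol, hCol'⟩ :=
    ColemanLinear.exists_colemanLinearMap_two κ (closureEmb (K := ℚ) (v.adicCompletion ℚ)) W hg hd htr
  set colF : (localTowerPointsOfEmb κ (closureEmb (K := ℚ) (v.adicCompletion ℚ)) W →+ ℤ_[2]) →ₗ[IwasawaAlgebra 2]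
      IwasawaAlgebra 2 := (LinearMap.snd (IwasawaAlgebra 2) (IwasawaAlgebra 2) (IwasawaAlgebra 2)).comp Col with hcolF
  have hcolF_apply : ∀ z, colF z = (Col z).2 := fun z ↦ rfl
  -- `P := Hom ⧸ Ker Col♭`, `ι_P := Col♭` descended, `q :=` the projection
  set K : Submodule (IwasawaAlgebra 2) (localTowerPointsOfEmb κ (closureEmb (K := ℚ) (v.adicCompletion ℚ)) W →+ ℤ_[2]) :=
    LinearMap.ker colF with hK
  have hKle : K ≤ LinearMap.ker colF := le_of_eq hK
  -- `j := j₀ ∘ res_{A⁺}` descends along `Ker Col♭ ⊆ ker j₀`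
  set incl := AddSubgroup.inclusion (iSup_signedLocalPoints_le_localTowerPointsOfEmb W 2 κ 1 v) with hincl
  set j₁ : (localTowerPointsOfEmb κ (closureEmb (K := ℚ) (v.adicCompletion ℚ)) W →+ ℤ_[2]) →+ D.X :=
    j₀.comp (AddMonoidHom.compHom' incl) with hj₁
  have hj₁_apply : ∀ z, j₁ z = j₀ (z.comp incl) := fun z ↦ rfl
  have hKj : K.toAddSubgroup ≤ j₁.ker := by
    intro z hz
    rw [AddMonoidHom.mem_ker, hj₁_apply]
    have hz' : (Col z).2 = 0 := by
      rw [← hcolF_apply]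
      exact hz
    have hzK : z ∈ colemanKer κ (closureEmb (K := ℚ) (v.adicCompletion ℚ)) W 0 g d .flat :=
      (ColemanLinear.mem_colemanKer_flat_iff_of_colemanLinearMap κ _ W hg Col hCol hCol' z).2 hz'
    exact pointsModelJ_comp_eq_zero_of_mem_colemanKer_flat_two W hss hκ v hv hg hd htr hgen hgen0 D j₀ hj hzK
  have hA : ∀ a ∈ (⨆ n, signedLocalPoints κ (v.adicCompletion ℚ) W 1 n),
      g • a ∈ (⨆ n, signedLocalPoints κ (v.adicCompletion ℚ) W 1 n) :=
    fun a ha ↦ smul_mem_iSup_signedLocalPoints W κ _ 1 g ha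
  refine ⟨(localTowerPointsOfEmb κ (closureEmb (K := ℚ) (v.adicCompletion ℚ)) W →+ ℤ_[2]) ⧸ K, inferInstance, inferInstance,
    K.liftQ colF hKle, K.mkQ.toAddMonoidHom, (QuotientAddGroup.lift K.toAddSubgroup j₁ hKj :
      ((localTowerPointsOfEmb κ (closureEmb (K := ℚ) (v.adicCompletion ℚ)) W →+ ℤ_[2]) ⧸ K) →+ D.X),
    ?_, Submodule.mkQ_surjective K, fun f z ↦ ?_, fun z ↦ ⟨(Col z).1, ?_⟩, fun z Ls Lf h ↦ ?_, fun z ↦ rfl, fun f y ↦ ?_,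
    fun x hx ↦ ?_⟩
  · -- `ι_P` is injective: `K = ker Col♭`
    exact LinearMap.ker_eq_bot.1 (Submodule.ker_liftQ_eq_bot K colF hKle (le_of_eq hK.symm))
  · -- `q` is `Λ`-compatible
    rw [← moduleOfGenerator_smul_eq]
    exact map_smul K.mkQ f z
  · -- `ι_P (q z) = Col♭ z` is the ♭-Coleman value
    have e : K.liftQ colF hKle (K.mkQ z) = (Col z).2 := by
      rw [Submodule.mkQ_apply, Submodule.liftQ_apply, hcolF_apply]
    change IsColemanPair κ _ W 0 g d z (Col z).1 (K.liftQ colF hKle (K.mkQ z))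
    rw [e]
    exact hCol z
  · change K.liftQ colF hKle (K.mkQ z) = Lf
    rw [Submodule.mkQ_apply, Submodule.liftQ_apply, hcolF_apply, hCol' z Ls Lf h]
  · -- `ι`-semilinearity
    obtain ⟨z, rfl⟩ := Submodule.mkQ_surjective K y
    rw [← map_smul, moduleOfGenerator_smul_eq]
    change j₁ (lambdaSMul κ _ W hg f z) = IwasawaAlgebra.invol 2 f • j₁ z
    rw [hj₁_apply, hj₁_apply]
    exact pointsModelJ_lambdaSMul W κ 1 v hv' hγ hg hA D j₀ hj
      (iSup_signedLocalPoints_le_localTowerPointsOfEmb W 2 κ 1 v) f z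
  · -- the local cover, exponent `0`
    obtain ⟨z, hz⟩ := exists_pointsModelJ_comp_eq_of_localCover_two W κ 1 v hv D j₀ hj x (fun s hs h ↦ hx ⟨s, hs⟩ h)
    exact ⟨K.mkQ z, hz⟩

end SignedKatoOffTwo.KummerPoint

end Summit.BirchSwinnertonDyer.BirchSwinnertonDyer.Theorems

end
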